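import Summits.ResolutionOfSingularities.ResolutionOfSingularities.Theorems.EquisingularLiftEquisingularLiftNatExactShadowCJS
import Summits.ResolutionOfSingularities.ResolutionOfSingularities.Theorems.TeissierJungTeissierReductionLowDim
import Literature.AlgebraicGeometry.Resolution.ProjectiveSpaceRegular
import HarnessLib

/-!
# [OURS · L1 W4.5(b) · EL♮] T-EXACT-SHADOW, two closing corollaries: the REGULAR case over any `(O, π)` (zero steps) and
# «CJS + exact lifts ⇒ EL♮(3)» for surfaces in `ℙ³` WITHOUT the dimension binder (res-L1-w45b-lead-2's TARGET (6), file 5)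

Crux `EquisingularLiftNat` = stmt-ResolutionOfSingularities-20038 (route EquisingularLift), line `sections`, and its child EL♮(3)
(stmt-ResolutionOfSingularities-20148); helper file `--supports … --as helper` by res-D-pv-037. HONEST FRAMING: OURS (cell res-hironaka,
slot W4.5(b)); NOT a statement of any manuscript; `elNatOver_of_CJSPermissible_three` is CONDITIONAL on the Literature named fact
`CossartJannsenSaito2020SequencePermissible` (CJS, LNM 2270, Thm. 1.2 as printed) and on the exact-lift hypothesis `(MS)` (explicit
binder). AI-written, weaker than expert review. No `sorry`; standard axioms.

* `elNatOver_of_isRegular` — **EL♮ over ANY `(O, π)` for a REGULAR `H ⊆ ℙⁿ_k`**: the engine `elNatOver_of_exactShadow` (p510833) with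
  the EMPTY admissibility predicate `Adm := ⊥` — the downstairs closure is reached in zero steps and `(MS)` is vacuous. (The tree's
  `elnat_of_isRegular` p498240 gives the item's `∃ O` form with `O = 𝕎(k)`; this is the `ELNatOver` form for a given lift ring.)
* `elNatOver_of_CJSPermissible_three` / `elNatAt_of_CJSPermissible_three` — for `ι : H → ℙ³_k`: either `ι` is an isomorphism (then
  `H` is regular, `isRegular_projectiveSpace`, previous corollary) or `dim H ≤ 2`
  (`Theorems.TeissierReduction.isIso_or_topologicalKrullDim_le_of_isClosedImmersion_projectiveSpace`), and then `elNatOver_of_CJSPermissible`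
  (file 4, p512696) applies: CJS Thm. 1.2 + exact admissible lifts of the regular centres ⇒ `ELNatOver p k 3 H ι O π`.

References: …NatExactShadowCJS.lean (p512696), …NatExactShadowRegularCentres.lean (p511733), …NatExactShadowELNat.lean (p510833),
…NatExactShadow.lean (p509671); …TeissierJungTeissierReductionLowDim.lean (dimension dichotomy); Literature/…/ProjectiveSpaceRegular.lean;
Cossart–Jannsen–Saito LNM 2270 Thm. 1.2; L/w45b/CHAIN.md v7.3.
-/

set_option linter.dupNamespace false -- mandated namespace `Summit.<Summit>.<Problem>` of this single-conjunct summit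
set_option linter.overlappingInstances false -- signatures carry `[IsDomain O] [IsDiscreteValuationRing O]`

noncomputable section

open CategoryTheory CategoryTheory.Limits AlgebraicGeometry TopologicalSpace Topology
open MvPolynomial HomogeneousIdeal
open Literature.AlgebraicGeometry.Resolution
open AlgebraicGeometry.Scheme.IdealSheafData
open Summit.ResolutionOfSingularities.ResolutionOfSingularities.Theses.EquisingularLift.Split
open Summit.ResolutionOfSingularities.ResolutionOfSingularities.Cruxes.EquisingularLift.StrataSplit

namespace Summit.ResolutionOfSingularities.ResolutionOfSingularities.Cruxes.EquisingularLiftNat.Sections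

/-- **EL♮ over any lift ring for a REGULAR `H`** (zero steps of the exact-shadow engine, `Adm := ⊥`): for `H ⊆ ℙⁿ_k` integral and
regular and any characteristic-0 DVR `O` with a surjection `π : O → k`, `Theorems.EquisingularLift.ELNatOver p k n H ι O π`. [folklore] -/
theorem elNatOver_of_isRegular {p : ℕ} (k : Type) [Field k] [CharP k p] [IsAlgClosed k] (n : ℕ) (H : Scheme.{0})
    (ι : H ⟶ (Literature.AlgebraicGeometry.Motives.projectiveSpace n k).left) [IsClosedImmersion ι] [IsIntegral H]
    (hH : Scheme.IsRegular H) (O : Type) [CommRing O] [IsDomain O] [IsDiscreteValuationRing O] [CharZero O] (π : O →+* k)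
    (hπ : Function.Surjective π) : Theorems.EquisingularLift.ELNatOver p k n H ι O π :=
  elNatOver_of_exactShadow k n H ι O π hπ (fun _ _ => False) (fun _ _ _ _ h => h) ⟨H, fun _ h0 _ => h0, hH⟩
    (fun _ _ _ _ _ _ _ _ _ _ _ _ _ _ _ h => h.elim)

/-- **COSSART–JANNSEN–SAITO + EXACT ADMISSIBLE LIFTS ⇒ `ELNatOver` FOR SURFACES IN `ℙ³`** (no dimension binder): conditional on the
named fact `CossartJannsenSaito2020SequencePermissible`; for `H ⊆ ℙ³_k` integral and a characteristic-0 DVR `O` with `π : O ↠ k`, if at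
every horizontal-E1 stage over `ℙ³_O` every ideal sheaf `D` of the reduced strict transform with `V(D)` regular and `supp D ⊆ Sing` has
an exact admissible lift, then EL♮ holds for `H` over `(O, π)`. [cite: CossartJannsenSaito2020, Thm. 1.2 (p. 5)] -/
theorem elNatOver_of_CJSPermissible_three (hCJS : CossartJannsenSaito2020SequencePermissible.{0})
    {p : ℕ} (k : Type) [Field k] [CharP k p] [IsAlgClosed k]
    (H : Scheme.{0}) (ι : H ⟶ (Literature.AlgebraicGeometry.Motives.projectiveSpace 3 k).left) [IsClosedImmersion ι]
    [IsIntegral H] (O : Type) [CommRing O] [IsDomain O] [IsDiscreteValuationRing O] [CharZero O] (π : O →+* k)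
    (hπ : Function.Surjective π)
    (hMS : letI := MvPolynomial.gradedAlgebra (σ := Fin (3 + 1)) (R := O);
      letI := MvPolynomial.gradedAlgebra (σ := Fin (3 + 1)) (R := k);
      ∀ (φ : homogeneousSubmodule (Fin (3 + 1)) O →+*ᵍ homogeneousSubmodule (Fin (3 + 1)) k)
        (hφ' : HomogeneousIdeal.irrelevant (homogeneousSubmodule (Fin (3 + 1)) k) ≤
          (HomogeneousIdeal.irrelevant (homogeneousSubmodule (Fin (3 + 1)) O)).map φ),
        (∀ s, φ s = MvPolynomial.map π s) →
      ∀ (X₁ : Scheme.{0}) (σ₁ : X₁ ⟶ Proj (homogeneousSubmodule (Fin (3 + 1)) O)) (S₁ : Set X₁),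
        (∀ Q : (∀ X' : Scheme.{0}, (X' ⟶ Proj (homogeneousSubmodule (Fin (3 + 1)) O)) → Set X' → Prop),
          Q (Proj (homogeneousSubmodule (Fin (3 + 1)) O)) (𝟙 _) (Set.range (ι ≫ Proj.map φ hφ')) →
          (∀ (X' X'' : Scheme.{0}) (σ' : X' ⟶ Proj (homogeneousSubmodule (Fin (3 + 1)) O)) (Y' : Set X')
            (C : X'.IdealSheafData) (τ : X'' ⟶ X'), Q X' σ' Y' → IsBlowup τ C → Scheme.IsRegular C.subscheme →
            Flat (C.subschemeι ≫ σ' ≫ Proj.toSpecZero (homogeneousSubmodule (Fin (3 + 1)) O) ≫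
              Spec.map (CommRingCat.ofHom (algebraMap O (homogeneousSubmodule (Fin (3 + 1)) O 0)))) →
            σ' '' (C.support : Set X') ⊆ {x | ¬ IsGenericPoint x (Set.range (ι ≫ Proj.map φ hφ'))} →
            (C.support : Set X') ∩ (σ' ≫ Proj.toSpecZero (homogeneousSubmodule (Fin (3 + 1)) O) ≫
              Spec.map (CommRingCat.ofHom (algebraMap O (homogeneousSubmodule (Fin (3 + 1)) O 0)))) ⁻¹'
              {IsLocalRing.closedPoint O} ⊆ Y' →
            Q X'' (τ ≫ σ') (closure (τ ⁻¹' (Y' \ (C.support : Set X'))))) → Q X₁ σ₁ S₁) →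
        IsLocallyNoetherian X₁ → Scheme.IsRegular X₁ →
        IsProper (σ₁ ≫ Proj.toSpecZero (homogeneousSubmodule (Fin (3 + 1)) O) ≫
          Spec.map (CommRingCat.ofHom (algebraMap O (homogeneousSubmodule (Fin (3 + 1)) O 0)))) →
        IsClosed S₁ → IsIrreducible S₁ →
        S₁ ⊆ (σ₁ ≫ Proj.toSpecZero (homogeneousSubmodule (Fin (3 + 1)) O) ≫
          Spec.map (CommRingCat.ofHom (algebraMap O (homogeneousSubmodule (Fin (3 + 1)) O 0)))) ⁻¹'
          {IsLocalRing.closedPoint O} →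
        ∀ D : ((vanishingIdeal (⟨closure S₁, isClosed_closure⟩ : Closeds X₁)).subscheme).IdealSheafData,
          (D.support : Set ↥(vanishingIdeal (⟨closure S₁, isClosed_closure⟩ : Closeds X₁)).subscheme) ⊆
            (Scheme.regularLocus (vanishingIdeal (⟨closure S₁, isClosed_closure⟩ : Closeds X₁)).subscheme)ᶜ →
          Scheme.IsRegular D.subscheme →
          ∃ C : X₁.IdealSheafData, Scheme.IsRegular C.subscheme ∧
            Flat (C.subschemeι ≫ σ₁ ≫ Proj.toSpecZero (homogeneousSubmodule (Fin (3 + 1)) O) ≫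
              Spec.map (CommRingCat.ofHom (algebraMap O (homogeneousSubmodule (Fin (3 + 1)) O 0)))) ∧
            (C.support : Set X₁) ∩ (σ₁ ≫ Proj.toSpecZero (homogeneousSubmodule (Fin (3 + 1)) O) ≫
              Spec.map (CommRingCat.ofHom (algebraMap O (homogeneousSubmodule (Fin (3 + 1)) O 0)))) ⁻¹'
              {IsLocalRing.closedPoint O} ⊆ S₁ ∧
            C.comap (vanishingIdeal (⟨closure S₁, isClosed_closure⟩ : Closeds X₁)).subschemeι = D) :
    Theorems.EquisingularLift.ELNatOver p k 3 H ι O π := by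
  rcases Theorems.TeissierReduction.isIso_or_topologicalKrullDim_le_of_isClosedImmersion_projectiveSpace 2 ι with hiso | hdim
  · haveI := hiso
    have hreg : Scheme.IsRegular H :=
      Scheme.IsRegular.of_iso (inv ι) (isRegular_projectiveSpace 3 k)
    exact elNatOver_of_isRegular k 3 H ι hreg O π hπ
  · exact elNatOver_of_CJSPermissible hCJS k 3 H ι (by exact_mod_cast hdim) O π hπ hMS

/-- **COSSART–JANNSEN–SAITO + EXACT ADMISSIBLE LIFTS ⇒ `ELNatAt` FOR SURFACES IN `ℙ³`** — the same packaged with `elNatAt_of_elNatOver`.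
[cite: CossartJannsenSaito2020, Thm. 1.2 (p. 5)] -/
theorem elNatAt_of_CJSPermissible_three (hCJS : CossartJannsenSaito2020SequencePermissible.{0})
    {p : ℕ} (k : Type) [Field k] [CharP k p] [IsAlgClosed k]
    (H : Scheme.{0}) (ι : H ⟶ (Literature.AlgebraicGeometry.Motives.projectiveSpace 3 k).left) [IsClosedImmersion ι]
    [IsIntegral H] (O : Type) [CommRing O] [IsDomain O] [IsDiscreteValuationRing O] [CharZero O] (π : O →+* k)
    (hπ : Function.Surjective π)
    (hMS : letI := MvPolynomial.gradedAlgebra (σ := Fin (3 + 1)) (R := O);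
      letI := MvPolynomial.gradedAlgebra (σ := Fin (3 + 1)) (R := k);
      ∀ (φ : homogeneousSubmodule (Fin (3 + 1)) O →+*ᵍ homogeneousSubmodule (Fin (3 + 1)) k)
        (hφ' : HomogeneousIdeal.irrelevant (homogeneousSubmodule (Fin (3 + 1)) k) ≤
          (HomogeneousIdeal.irrelevant (homogeneousSubmodule (Fin (3 + 1)) O)).map φ),
        (∀ s, φ s = MvPolynomial.map π s) →
      ∀ (X₁ : Scheme.{0}) (σ₁ : X₁ ⟶ Proj (homogeneousSubmodule (Fin (3 + 1)) O)) (S₁ : Set X₁),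
        (∀ Q : (∀ X' : Scheme.{0}, (X' ⟶ Proj (homogeneousSubmodule (Fin (3 + 1)) O)) → Set X' → Prop),
          Q (Proj (homogeneousSubmodule (Fin (3 + 1)) O)) (𝟙 _) (Set.range (ι ≫ Proj.map φ hφ')) →
          (∀ (X' X'' : Scheme.{0}) (σ' : X' ⟶ Proj (homogeneousSubmodule (Fin (3 + 1)) O)) (Y' : Set X')
            (C : X'.IdealSheafData) (τ : X'' ⟶ X'), Q X' σ' Y' → IsBlowup τ C → Scheme.IsRegular C.subscheme →
            Flat (C.subschemeι ≫ σ' ≫ Proj.toSpecZero (homogeneousSubmodule (Fin (3 + 1)) O) ≫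
              Spec.map (CommRingCat.ofHom (algebraMap O (homogeneousSubmodule (Fin (3 + 1)) O 0)))) →
            σ' '' (C.support : Set X') ⊆ {x | ¬ IsGenericPoint x (Set.range (ι ≫ Proj.map φ hφ'))} →
            (C.support : Set X') ∩ (σ' ≫ Proj.toSpecZero (homogeneousSubmodule (Fin (3 + 1)) O) ≫
              Spec.map (CommRingCat.ofHom (algebraMap O (homogeneousSubmodule (Fin (3 + 1)) O 0)))) ⁻¹'
              {IsLocalRing.closedPoint O} ⊆ Y' →
            Q X'' (τ ≫ σ') (closure (τ ⁻¹' (Y' \ (C.support : Set X'))))) → Q X₁ σ₁ S₁) →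
        IsLocallyNoetherian X₁ → Scheme.IsRegular X₁ →
        IsProper (σ₁ ≫ Proj.toSpecZero (homogeneousSubmodule (Fin (3 + 1)) O) ≫
          Spec.map (CommRingCat.ofHom (algebraMap O (homogeneousSubmodule (Fin (3 + 1)) O 0)))) →
        IsClosed S₁ → IsIrreducible S₁ →
        S₁ ⊆ (σ₁ ≫ Proj.toSpecZero (homogeneousSubmodule (Fin (3 + 1)) O) ≫
          Spec.map (CommRingCat.ofHom (algebraMap O (homogeneousSubmodule (Fin (3 + 1)) O 0)))) ⁻¹'
          {IsLocalRing.closedPoint O} →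
        ∀ D : ((vanishingIdeal (⟨closure S₁, isClosed_closure⟩ : Closeds X₁)).subscheme).IdealSheafData,
          (D.support : Set ↥(vanishingIdeal (⟨closure S₁, isClosed_closure⟩ : Closeds X₁)).subscheme) ⊆
            (Scheme.regularLocus (vanishingIdeal (⟨closure S₁, isClosed_closure⟩ : Closeds X₁)).subscheme)ᶜ →
          Scheme.IsRegular D.subscheme →
          ∃ C : X₁.IdealSheafData, Scheme.IsRegular C.subscheme ∧
            Flat (C.subschemeι ≫ σ₁ ≫ Proj.toSpecZero (homogeneousSubmodule (Fin (3 + 1)) O) ≫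
              Spec.map (CommRingCat.ofHom (algebraMap O (homogeneousSubmodule (Fin (3 + 1)) O 0)))) ∧
            (C.support : Set X₁) ∩ (σ₁ ≫ Proj.toSpecZero (homogeneousSubmodule (Fin (3 + 1)) O) ≫
              Spec.map (CommRingCat.ofHom (algebraMap O (homogeneousSubmodule (Fin (3 + 1)) O 0)))) ⁻¹'
              {IsLocalRing.closedPoint O} ⊆ S₁ ∧
            C.comap (vanishingIdeal (⟨closure S₁, isClosed_closure⟩ : Closeds X₁)).subschemeι = D) :
    Theorems.EquisingularLift.ELNatAt p k 3 H ι :=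
  Theorems.EquisingularLift.elNatAt_of_elNatOver hπ (elNatOver_of_CJSPermissible_three hCJS k H ι O π hπ hMS)

end Summit.ResolutionOfSingularities.ResolutionOfSingularities.Cruxes.EquisingularLiftNat.Sections

end
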